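/-
Copyright (c) 2026 the pub-hodgecm-mathlib formalisation cell (harness21).  Prover seat hodgecm-mathlib-K2E1-p11 (g2), Track B ∕ K2-LIT, h413 =
`stmt-HodgeConjecture-24833`, line `K2_E1_TraceFormulaBeta`, 5Res campaign «ENDGAME BY FAMILIES» ∕ ROADCARD §3′ (M2 v2), deal (222) «the M2 arch letters at circle phase», FILE 1 (abstract,
Mathlib-only): NON-VANISHING and NON-CONSTANCY of a symbol `s(z) = ∫ h(y)·Φ(y)·R(y)^z dν(y)` from ONE non-negative bump `h` supported where `Re Φ ≥ ½` — positivity of the real part, and the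
exact SECOND DIFFERENCE `s(z+1) + s(z−1) − 2s(z) = ∫ h·Φ·R^{z−1}(R − 1)²`.
-/
import Mathlib.MeasureTheory.Integral.Bochner.ContinuousLinearMap
import Mathlib.Analysis.SpecialFunctions.Pow.Complex
import Mathlib.Analysis.SpecialFunctions.Pow.Real
import HarnessLib

/-!
# (222) FILE 1 — `K2E1SymbolPositivitySecondDifference`: `Re ∫ h·Φ·w ≥ ½∫h` and the second difference `s(z+1)+s(z−1)−2s(z) = ∫ h·Φ·R^{z−1}(R−1)²` — one central bump near `1` pays
# both arch letters `hs0` (`s z₀ ≠ 0`) and `hnc` (`s` non-constant), for every circle phase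

Cell `pub/hodgecm-mathlib`, crux H413 = `stmt-HodgeConjecture-24833`, route `HCCMUnconditional`; dealer K2E1-plan (g7) ruling (222) (the simplification «self-dual χ ⇒ circle characters only»)
and this seat's REPORT-FIRST 12:44Z (the second-difference road).  THEOREMS ONLY (no `def` ∕ `instance` ∕ `notation` ∕ named-fact hypothesis ∕ `sorry`); lane `--kind proof --supports
stmt-HodgeConjecture-24833 --as helper` (count-neutral; closes no socket).  GENERIC: any measure space `(Y, ν)`, a weight `h : Y → ℝ`, `h ≥ 0`, a phase-carrying factor `Φ : Y → ℂ` and a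
positive ratio `R : Y → ℝ` — in the E1 instantiation (FILE 2) `Y = G(𝔸)`, `ν` = Haar, `h = h_∞ ⊗ 𝟙_U` a `K_∞`-central bump near `1`, `Φ(y) = φ₀(x₀y)∕φ₀(x₀)` (a continuous `(χ̃, ω)`-section,
`Φ(1) = 1`), `R(y) = H(x₀y)∕H(x₀)`, and `s(z) = ∫ h·Φ·R^z` is the entire symbol of ★ P1 `exists_entire_symbol_of_arch` (K2-defs1 p860003) read through ★
`K2E1EquivariantSectionLine.rightConv_eq_smul_of_apply_one_ne_zero`.
THE MATHEMATICS (elementary; [BernsteinLapid2019, §4 Claim 1] for the role of the symbol; [Langlands1976, §6]).  (§1) If `h ≥ 0` and `Re(Φ·w) ≥ ½` wherever `h ≠ 0`, then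
`Re ∫ h·Φ·w dν ≥ ½∫ h dν`; so `∫ h > 0 ⟹ ∫ h·Φ·w ≠ 0` — the letter `hs0` at any `z₀` once the bump sits inside `{Re(Φ·R^{z₀}) ≥ ½}` (an open neighbourhood of `1`).  (§2) For `R > 0` and every
`z ∈ ℂ`: `R^{z+1} + R^{z−1} − 2R^z = R^{z−1}(R − 1)²`, hence **`s(z+1) + s(z−1) − 2s(z) = ∫ h·Φ·R^{z−1}·(R−1)² dν`**; at a REAL `z = σ` the new weight `h·R^{σ−1}(R−1)² ≥ 0` vanishes exactly where
`h = 0` or `R = 1`, so by §1 the second difference has real part `≥ ½∫ h·R^{σ−1}(R−1)² > 0` as soon as `h` charges `{R ≠ 1}` (positive `ν`-measure) — and then `s(σ−1), s(σ), s(σ+1)` are not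
all equal: the letter `hnc` WITHOUT evaluating a single phase and without Laplace asymptotics (a `K_∞`-central bump at a torus point would not do: its `K_∞`-orbit meets `{H < 1}`).
* §1 `re_ofReal_mul_apply`, **`half_integral_le_re_integral`**, **`integral_ne_zero_of_re_ge_half`** (`hs0`-engine).
* §2 `cpow_add_one_add_cpow_sub_one_sub`, **`secondDiff_eq_integral`**, `ofReal_mul_cpow_real_eq`, **`re_secondDiff_pos`**, **`exists_apply_ne_apply_of_secondDiff`** (`hnc`-engine).
HONEST LABEL.  Count-neutral helper; proves no printed statement; Mathlib-only; the arch-side instantiation (the `K_∞`-central gauge bump `ψ(Σ_w‖(g_∞ − 1)_w‖²_F) ⊗ 𝟙_U`, `1 ∈ closure{H ≠ 1}`,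
Haar open-positivity) is FILE 2.  HC_CM is proved only modulo the 7 printed citations (2 remaining named inputs: hLiu418 = `stmt-HodgeConjecture-24832`, h413 = `stmt-HodgeConjecture-24833`)
until rung 0 closes.

## References
* [BernsteinLapid2019] J. Bernstein, E. Lapid, *On the meromorphic continuation of Eisenstein series*, J. AMS 37 (2024), §4 Claim 1 (the scalar symbol of a central test function).
* [Langlands1976] R. P. Langlands, *On the Functional Equations Satisfied by Eisenstein Series*, LNM 544 (1976), §6.
* [Folland1999] G. B. Folland, *Real Analysis* (2nd ed., 1999), §2.3 (positivity of the integral).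
-/

set_option autoImplicit false
-- the mandated namespace repeats `HodgeConjecture.HodgeConjecture`, as in every `Theorems/*.lean` of this sub-problem
set_option linter.dupNamespace false

noncomputable section

open MeasureTheory MeasureTheory.Measure Set Filter Topology Complex

namespace Summit.HodgeConjecture.HodgeConjecture.Cruxes.H413.K2E1SymbolPositivitySecondDifference

variable {Y : Type*} [MeasurableSpace Y] (ν : Measure Y)

/-! ## §1 Positivity of the real part: `Re ∫ h·F ≥ ½∫h` when `h ≥ 0` and `Re F ≥ ½` on `{h ≠ 0}` -/

omit [MeasurableSpace Y] in
/-- `Re(h·F) = h·Re F` for a real weight `h`. [folklore] -/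
theorem re_ofReal_mul_apply (h : Y → ℝ) (F : Y → ℂ) (y : Y) : ((((h y : ℝ)) : ℂ) * F y).re = h y * (F y).re := by
  rw [Complex.re_ofReal_mul]

/-- **`½∫ h ≤ Re ∫ h·F`** for `h ≥ 0` with `Re F ≥ ½` wherever `h ≠ 0` (both integrands integrable). [cite: Folland1999, §2.3] -/
theorem half_integral_le_re_integral {h : Y → ℝ} {F : Y → ℂ} (hh : ∀ y, 0 ≤ h y) (hF : ∀ y, h y ≠ 0 → (1 / 2 : ℝ) ≤ (F y).re)
    (hhi : Integrable h ν) (hint : Integrable (fun y => (((h y : ℝ)) : ℂ) * F y) ν) :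
    (∫ y, h y ∂ν) / 2 ≤ (∫ y, (((h y : ℝ)) : ℂ) * F y ∂ν).re := by
  have hre : (∫ y, (((h y : ℝ)) : ℂ) * F y ∂ν).re = ∫ y, h y * (F y).re ∂ν := by
    have h1 := integral_re hint
    simp only [RCLike.re_to_complex, Complex.re_ofReal_mul] at h1
    exact h1.symm
  rw [hre, div_eq_mul_inv, ← integral_mul_const]
  refine integral_mono (hhi.mul_const _) ?_ fun y => ?_
  · have h2 : Integrable (fun y => ((((h y : ℝ)) : ℂ) * F y).re) ν := hint.re
    simp only [Complex.re_ofReal_mul] at h2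
    exact h2
  · by_cases hy : h y = 0
    · simp only [hy, zero_mul, le_refl]
    · rw [show h y * 2⁻¹ = h y * (1 / 2 : ℝ) by norm_num]
      exact mul_le_mul_of_nonneg_left (hF y hy) (hh y)

/-- **`hs0`-ENGINE — `∫ h·F ≠ 0`** when moreover `∫ h > 0` (`Re ∫ h·F ≥ ½∫h > 0`). [cite: BernsteinLapid2019, §4 Claim 1] -/
theorem integral_ne_zero_of_re_ge_half {h : Y → ℝ} {F : Y → ℂ} (hh : ∀ y, 0 ≤ h y) (hF : ∀ y, h y ≠ 0 → (1 / 2 : ℝ) ≤ (F y).re)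
    (hhi : Integrable h ν) (hint : Integrable (fun y => (((h y : ℝ)) : ℂ) * F y) ν) (hpos : 0 < ∫ y, h y ∂ν) :
    ∫ y, (((h y : ℝ)) : ℂ) * F y ∂ν ≠ 0 := by
  intro h0
  have h1 := half_integral_le_re_integral ν hh hF hhi hint
  rw [h0, Complex.zero_re] at h1
  linarith

/-! ## §2 The second difference `s(z+1) + s(z−1) − 2s(z) = ∫ h·Φ·R^{z−1}(R − 1)²` and non-constancy -/

omit [MeasurableSpace Y] in
/-- `r^{z+1} + r^{z−1} − 2r^z = r^{z−1}·(r − 1)²` for a real `r > 0` and complex `z`. [folklore] -/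
theorem cpow_add_one_add_cpow_sub_one_sub {r : ℝ} (hr : 0 < r) (z : ℂ) :
    ((r : ℂ) ^ (z + 1)) + ((r : ℂ) ^ (z - 1)) - 2 * ((r : ℂ) ^ z) = ((r : ℂ) ^ (z - 1)) * (((r : ℂ)) - 1) ^ 2 := by
  have hr0 : ((r : ℂ)) ≠ 0 := ofReal_ne_zero.2 hr.ne'
  have h1 : ((r : ℂ) ^ (z + 1)) = ((r : ℂ) ^ (z - 1)) * (r : ℂ) ^ 2 := by
    rw [show z + 1 = (z - 1) + 2 by ring, cpow_add _ _ hr0, cpow_two]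
  have h2 : ((r : ℂ) ^ z) = ((r : ℂ) ^ (z - 1)) * (r : ℂ) := by
    rw [show z = (z - 1) + 1 by ring, cpow_add _ _ hr0, cpow_one, show z - 1 + 1 - 1 = z - 1 by ring]
  rw [h1, h2]
  ring

/-- **THE SECOND-DIFFERENCE IDENTITY**: for `s(z) = ∫ h·Φ·R^z dν` (`R > 0`; the three integrands integrable),
`s(z+1) + s(z−1) − 2s(z) = ∫ h(y)·Φ(y)·R(y)^{z−1}·(R(y) − 1)² dν(y)`. [cite: BernsteinLapid2019, §4 Claim 1] -/
theorem secondDiff_eq_integral {h : Y → ℝ} {Φ : Y → ℂ} {R : Y → ℝ} (hR : ∀ y, 0 < R y) (z : ℂ)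
    (hp : Integrable (fun y => (((h y : ℝ)) : ℂ) * (Φ y * (((R y : ℝ) : ℂ) ^ (z + 1)))) ν) (hm : Integrable (fun y => (((h y : ℝ)) : ℂ) * (Φ y * (((R y : ℝ) : ℂ) ^ (z - 1)))) ν)
    (h0 : Integrable (fun y => (((h y : ℝ)) : ℂ) * (Φ y * (((R y : ℝ) : ℂ) ^ z))) ν) :
    (∫ y, (((h y : ℝ)) : ℂ) * (Φ y * (((R y : ℝ) : ℂ) ^ (z + 1))) ∂ν) + (∫ y, (((h y : ℝ)) : ℂ) * (Φ y * (((R y : ℝ) : ℂ) ^ (z - 1))) ∂ν) -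
        2 * (∫ y, (((h y : ℝ)) : ℂ) * (Φ y * (((R y : ℝ) : ℂ) ^ z)) ∂ν) =
      ∫ y, (((h y : ℝ)) : ℂ) * (Φ y * ((((R y : ℝ) : ℂ) ^ (z - 1)) * ((((R y : ℝ)) : ℂ) - 1) ^ 2)) ∂ν := by
  have hadd : Integrable (fun y => (((h y : ℝ)) : ℂ) * (Φ y * (((R y : ℝ) : ℂ) ^ (z + 1))) + (((h y : ℝ)) : ℂ) * (Φ y * (((R y : ℝ) : ℂ) ^ (z - 1)))) ν := hp.add hm
  have h2 : Integrable (fun y => 2 * ((((h y : ℝ)) : ℂ) * (Φ y * (((R y : ℝ) : ℂ) ^ z)))) ν := h0.const_mul 2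
  have key : ∀ y, (((h y : ℝ)) : ℂ) * (Φ y * (((R y : ℝ) : ℂ) ^ (z + 1))) + (((h y : ℝ)) : ℂ) * (Φ y * (((R y : ℝ) : ℂ) ^ (z - 1))) -
      2 * ((((h y : ℝ)) : ℂ) * (Φ y * (((R y : ℝ) : ℂ) ^ z))) = (((h y : ℝ)) : ℂ) * (Φ y * ((((R y : ℝ) : ℂ) ^ (z - 1)) * ((((R y : ℝ)) : ℂ) - 1) ^ 2)) := by
    intro y
    rw [← cpow_add_one_add_cpow_sub_one_sub (hR y) z]
    ring
  calc (∫ y, (((h y : ℝ)) : ℂ) * (Φ y * (((R y : ℝ) : ℂ) ^ (z + 1))) ∂ν) + (∫ y, (((h y : ℝ)) : ℂ) * (Φ y * (((R y : ℝ) : ℂ) ^ (z - 1))) ∂ν) -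
        2 * (∫ y, (((h y : ℝ)) : ℂ) * (Φ y * (((R y : ℝ) : ℂ) ^ z)) ∂ν)
      = ∫ y, ((((h y : ℝ)) : ℂ) * (Φ y * (((R y : ℝ) : ℂ) ^ (z + 1))) + (((h y : ℝ)) : ℂ) * (Φ y * (((R y : ℝ) : ℂ) ^ (z - 1)))) -
          2 * ((((h y : ℝ)) : ℂ) * (Φ y * (((R y : ℝ) : ℂ) ^ z))) ∂ν := by
        rw [integral_sub hadd h2, integral_add hp hm, integral_const_mul]
    _ = ∫ y, (((h y : ℝ)) : ℂ) * (Φ y * ((((R y : ℝ) : ℂ) ^ (z - 1)) * ((((R y : ℝ)) : ℂ) - 1) ^ 2)) ∂ν := integral_congr_ae (Eventually.of_forall key)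

omit [MeasurableSpace Y] in
/-- At a REAL exponent the second-difference weight is real: `h·(Φ·(R^{σ−1}(R−1)²)) = (h·R^{σ−1}(R−1)²)·Φ` with `R^{σ−1}` the real power. [folklore] -/
theorem ofReal_mul_cpow_real_eq {h : Y → ℝ} {Φ : Y → ℂ} {R : Y → ℝ} (hR : ∀ y, 0 < R y) (σ : ℝ) (y : Y) :
    (((h y : ℝ)) : ℂ) * (Φ y * ((((R y : ℝ) : ℂ) ^ (((σ : ℝ) : ℂ) - 1)) * ((((R y : ℝ)) : ℂ) - 1) ^ 2)) =
      ((((h y * (R y ^ (σ - 1) * (R y - 1) ^ 2) : ℝ)) : ℂ)) * Φ y := by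
  have h1 : (((R y : ℝ) : ℂ) ^ (((σ : ℝ) : ℂ) - 1)) = ((((R y ^ (σ - 1) : ℝ)) : ℂ)) := by
    rw [show (((σ : ℝ) : ℂ)) - 1 = (((σ - 1 : ℝ)) : ℂ) by push_cast; ring, ofReal_cpow (hR y).le]
  rw [h1]
  push_cast
  ring

/-- **THE SECOND DIFFERENCE HAS POSITIVE REAL PART** at a real exponent `σ` when `h ≥ 0`, `Re Φ ≥ ½` on `{h ≠ 0}`, and `h` CHARGES `{R ≠ 1}` (`ν{h ≠ 0 ∧ R ≠ 1} ≠ 0`):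
`0 < Re ∫ h·Φ·R^{σ−1}(R−1)² dν`. [cite: BernsteinLapid2019, §4 Claim 1] [cite: Folland1999, §2.3] -/
theorem re_secondDiff_pos {h : Y → ℝ} {Φ : Y → ℂ} {R : Y → ℝ} (hh : ∀ y, 0 ≤ h y) (hR : ∀ y, 0 < R y) (hΦ : ∀ y, h y ≠ 0 → (1 / 2 : ℝ) ≤ (Φ y).re) (σ : ℝ)
    (hwi : Integrable (fun y => h y * (R y ^ (σ - 1) * (R y - 1) ^ 2)) ν)
    (hint : Integrable (fun y => (((h y : ℝ)) : ℂ) * (Φ y * ((((R y : ℝ) : ℂ) ^ (((σ : ℝ) : ℂ) - 1)) * ((((R y : ℝ)) : ℂ) - 1) ^ 2))) ν)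
    (hch : ν {y | h y ≠ 0 ∧ R y ≠ 1} ≠ 0) :
    0 < (∫ y, (((h y : ℝ)) : ℂ) * (Φ y * ((((R y : ℝ) : ℂ) ^ (((σ : ℝ) : ℂ) - 1)) * ((((R y : ℝ)) : ℂ) - 1) ^ 2)) ∂ν).re := by
  simp_rw [ofReal_mul_cpow_real_eq hR σ] at hint ⊢
  have hw0 : ∀ y, 0 ≤ h y * (R y ^ (σ - 1) * (R y - 1) ^ 2) := fun y => mul_nonneg (hh y) (mul_nonneg (Real.rpow_nonneg (hR y).le _) (sq_nonneg _))
  have hwF : ∀ y, h y * (R y ^ (σ - 1) * (R y - 1) ^ 2) ≠ 0 → (1 / 2 : ℝ) ≤ (Φ y).re := fun y hy => hΦ y (left_ne_zero_of_mul hy)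
  have hsupp : Function.support (fun y => h y * (R y ^ (σ - 1) * (R y - 1) ^ 2)) = {y | h y ≠ 0 ∧ R y ≠ 1} := by
    ext y
    simp only [Function.mem_support, mem_setOf_eq, mul_ne_zero_iff, pow_ne_zero_iff two_ne_zero, sub_ne_zero, (Real.rpow_pos_of_pos (hR y) _).ne', ne_eq, not_false_eq_true, true_and]
  have hpos : 0 < ∫ y, h y * (R y ^ (σ - 1) * (R y - 1) ^ 2) ∂ν := by
    rw [integral_pos_iff_support_of_nonneg hw0 hwi, hsupp]
    exact pos_iff_ne_zero.2 hch
  exact lt_of_lt_of_le (by linarith) (half_integral_le_re_integral ν hw0 hwF hwi hint)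

/-- **`hnc`-ENGINE — THE SYMBOL IS NOT CONSTANT.**  If `s : ℂ → ℂ` agrees with `z ↦ ∫ h·Φ·R^z dν` at the three real points `σ − 1, σ, σ + 1` (integrands integrable), `h ≥ 0`, `R > 0`,
`Re Φ ≥ ½` on `{h ≠ 0}` and `h` charges `{R ≠ 1}`, then `∃ z₁ z₂, s z₁ ≠ s z₂` (else the second difference, whose real part is `> 0`, would vanish).
[cite: BernsteinLapid2019, §4 Claim 1] [cite: Langlands1976, §6] -/
theorem exists_apply_ne_apply_of_secondDiff {h : Y → ℝ} {Φ : Y → ℂ} {R : Y → ℝ} (hh : ∀ y, 0 ≤ h y) (hR : ∀ y, 0 < R y) (hΦ : ∀ y, h y ≠ 0 → (1 / 2 : ℝ) ≤ (Φ y).re)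
    (σ : ℝ) {s : ℂ → ℂ} (hs : ∀ z ∈ ({(((σ : ℝ) : ℂ)) + 1, (((σ : ℝ) : ℂ)) - 1, (((σ : ℝ) : ℂ))} : Set ℂ), s z = ∫ y, (((h y : ℝ)) : ℂ) * (Φ y * (((R y : ℝ) : ℂ) ^ z)) ∂ν)
    (hp : Integrable (fun y => (((h y : ℝ)) : ℂ) * (Φ y * (((R y : ℝ) : ℂ) ^ ((((σ : ℝ) : ℂ)) + 1)))) ν)
    (hm : Integrable (fun y => (((h y : ℝ)) : ℂ) * (Φ y * (((R y : ℝ) : ℂ) ^ ((((σ : ℝ) : ℂ)) - 1)))) ν)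
    (h0 : Integrable (fun y => (((h y : ℝ)) : ℂ) * (Φ y * (((R y : ℝ) : ℂ) ^ (((σ : ℝ) : ℂ))))) ν)
    (hwi : Integrable (fun y => h y * (R y ^ (σ - 1) * (R y - 1) ^ 2)) ν)
    (hint : Integrable (fun y => (((h y : ℝ)) : ℂ) * (Φ y * ((((R y : ℝ) : ℂ) ^ (((σ : ℝ) : ℂ) - 1)) * ((((R y : ℝ)) : ℂ) - 1) ^ 2))) ν)
    (hch : ν {y | h y ≠ 0 ∧ R y ≠ 1} ≠ 0) :
    ∃ z₁ z₂ : ℂ, s z₁ ≠ s z₂ := by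
  by_contra hcon
  push Not at hcon
  have hd := secondDiff_eq_integral ν hR (((σ : ℝ) : ℂ)) hp hm h0
  rw [← hs _ (by simp), ← hs _ (by simp), ← hs _ (by simp), hcon ((((σ : ℝ) : ℂ)) + 1) (((σ : ℝ) : ℂ)), hcon ((((σ : ℝ) : ℂ)) - 1) (((σ : ℝ) : ℂ))] at hd
  have hre := re_secondDiff_pos ν hh hR hΦ σ hwi hint hch
  rw [← hd] at hre
  simp only [sub_re, add_re, mul_re, re_ofNat, im_ofNat, zero_mul, sub_zero] at hre
  linarith

end Summit.HodgeConjecture.HodgeConjecture.Cruxes.H413.K2E1SymbolPositivitySecondDifference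

end
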